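import Summits.ABC.IUTFork.Cor312SlotLicenceSingletonFibresM
import HarnessLib

/-!
# [IUTchIII] Cor. 3.12, Step (xi-f) at the M-LEVEL setting — readings (P) and (U) AGREE AT THE LICENCE LEVEL wherever the Θ-idele NORMS are
# CONSTANT ON THE FIBRES `V̲_u` (relaxing «subsingleton fibre» of `Cor312SlotLicenceSingletonFibresM`): `SlotLicence ↔ Licence`

PROOF-ONLY file (D-0012; no definitions, no `Prop` facts, no instances) of the abc-iut cell (branch C certificate seat abc-iut-C-cert-2 gen 4; row
«P:M-SLOT-LICENCE-EXACT», M corollary 2; M twin of this seat's `Cor312SlotLicenceNormConstK`, p475870). TAKES NO SIDE on [IUTchIII] Cor. 3.12 (kurims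
manuscript p. 173–174; Step (x) p. 181, Step (xi-f) p. 184) or on the reading (U)/(P).

At abc-iut-s2-p8's summand-route M-level sharp setting the two exact deciders — abc-iut-w5-d166's for the (U) licence
(`qRegion_subset_thetaHull_settingPrVolSharpM_iff_radii`, antecedent over ALL slots `a`) and this seat's for the (P) SLOT licence
(`qRegion_subset_thetaSlotHull_settingPrVolSharpM_iff_radii`, p470778, LAST slot only) — read the Θ-ideles only through their norms. Hence at a packet
`(j, u)` where `‖t_{Θ,j,v̲}‖` (the label-`j` idele, abc-iut-s2-p8 `labelIdele`) does NOT depend on the member `v̲ ∈ V̲_u` (`hΘ`; automatic over a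
subsingleton fibre — p473654 —, and e.g. at `d_mod ≥ 2` for Θ-pilot divisors place-symmetric over `p_u`), the two antecedents coincide:

* **`qRegion_subset_thetaSlotHull_iff_thetaHull_settingPrVolSharpM_of_norm_const`** (per packet; radii witnesses by abc-iut-w4-d026
  `exists_shellRadii_witnesses`, witness-free statement);
* **`slotLicence_iff_licence_settingPrVolSharpM_of_norm_const`** (`SlotLicence ↔ Thm311ToCor312.Licence` when `hΘ` holds at every finite place and
  label `i+1`); `not_licence_of_not_slotLicence_settingPrVolSharpM_of_norm_const` (then the antecedent of the M γ binders hNumPOffBad_M / hNumPOffC_M,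
  p469493, implies that of the (U) M binders — ¬S_H via abc-iut-w5-d068 `licence_of_pilotKummerCompatHull`).

HONEST SCOPE: `hΘ` is a HYPOTHESIS on the Θ-ideles, stated, not discharged (for the datum's own ideles `tOfIdeleData D r` it reads
`‖t_{q,v̲}‖^{(i+1)²}` constant over `V̲_u` — abc-iut-w5-d166 `norm_tThetaM_eq_norm_tqM_pow` —, i.e. place-symmetry of the q-pilot divisor over `p_u`);
statements about OUR typed objects; nothing here bears on the printed GLOBAL inequality or takes a side on any author; decided-as-typed ≠ in print; typed ≠
proved (these: proved). [cite: Mochizuki2012, IUTchIII Cor. 3.12 p. 173–174, Step (x) p. 181, Step (xi-f) p. 184; Thm. 3.11 (i) (Ind1)(Ind2) p. 154;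
IUTchI Def. 3.1 (e) p. 62] [cite: DupuyHilado2025, §3.4, §3.9, §4.9, §4.11–4.12] [claim: Mochizuki2012, status: disputed] for every IUT sentence quoted.
-/

noncomputable section

open Set Function NumberField IsDedekindDomain
open scoped Pointwise

namespace Summit.ABC.IUTFork.Thm311.Real

open Cor312 Cor312Vol Literature.IUT.LogThetaLattice Literature.IUT.LogVolume Literature.IUT.HodgeTheaters
  Literature.NumberTheory.NumberFields Literature.NumberTheory.GaloisRepresentations.Ultrametric

variable {F K Fbar : Type} [Field F] [NumberField F] [Field K] [NumberField K] [Algebra F K]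
  [Field Fbar] [Algebra F Fbar] [Algebra K Fbar] {E : WeierstrassCurve F} [E.IsElliptic] {l : ℕ}
  {Pb : BadPlacePredicates K} (D : InitialThetaData F K Fbar E l Pb) {logvK : PadicLogsVal K}
  (hlog : LogvAnalyticVal logvK)
  (t : ∀ (u : FinitePlace ℚ) (_ : Fin (thetaIndexOfInitial D).lstar) (x : (thetaIndexOfInitial D).Fibre (Val.non u)),
    kOfM D (ratChar u) u (natCast_ratChar_mem u) x)
  (tq : ∀ (u : FinitePlace ℚ) (x : (thetaIndexOfInitial D).Fibre (Val.non u)),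
    kOfM D (ratChar u) u (natCast_ratChar_mem u) x)
  (M : Type) [Field M] [NumberField M]
  (archPk : ∀ (j : (thetaIndexOfInitial D).Label) (vQ : (thetaIndexOfInitial D).VQ),
    Set ((logShellsOfInitialDH D logvK).Packet j vQ))
  (archSub : ∀ (j : (thetaIndexOfInitial D).Label) (v : (thetaIndexOfInitial D).V),
    Set ((logShellsOfInitialDH D logvK).Packet j ((thetaIndexOfInitial D).over v)))
  (Ψ : ℤ → ∀ v : (thetaIndexOfInitial D).V, v ∈ (thetaIndexOfInitial D).Vbad →
    Set ((logShellsOfInitialDH D logvK).StarPacket v))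
  (act : ℤ → ∀ v : (thetaIndexOfInitial D).V, v ∈ (thetaIndexOfInitial D).Vbad →
    (logShellsOfInitialDH D logvK).StarPacket v → Module.End ℚ ((logShellsOfInitialDH D logvK).StarPacket v))
  (Mmod : ℤ → ∀ j : (thetaIndexOfInitial D).LabelStar, Set ((logShellsOfInitialDH D logvK).GlobalPacket j.1))
  (region : ℤ → ∀ j : (thetaIndexOfInitial D).LabelStar, FinDivisor M → ∀ vQ : (thetaIndexOfInitial D).VQ,
    Set ((logShellsOfInitialDH D logvK).Packet j.1 vQ))
  (n : ℤ) {HT : Type} {LogLink : HT → HT → Type} {IsFull : ∀ {s t : HT}, LogLink s t → Prop}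
  (lat : LGPGaussianLogThetaLattice LogLink IsFull)
  {Frd : Type} {IsoF : Frd → Frd → Type} {Ob : Frd → Type} {realify : Frd → Frd} {Strip : Type}
  {IsoS : Strip → Strip → Type}
  {Mv : ∀ v : (thetaIndexOfInitial D).V, v ∈ (thetaIndexOfInitial D).Vbad → Type} [∀ v h, Monoid (Mv v h)]
  (sig : GlobalLGPFrobenioidSignature (thetaIndexOfInitial D).lstar (thetaIndexOfInitial D).V
    (· ∈ (thetaIndexOfInitial D).Vbad) Frd IsoF Ob realify Strip IsoS Mv)
  (split : SplittingMonoids Mv) {ObΔ : Type}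
  {N : ∀ v : (thetaIndexOfInitial D).V, v ∈ (thetaIndexOfInitial D).Vbad → Type} [∀ v h, Monoid (N v h)]
  (qData : QPilotData ObΔ N)
  (htq0 : ∀ u x, tq u x ≠ 0) (Sq : Finset (FinitePlace ℚ))
  (htq1 : ∀ (u : FinitePlace ℚ) (x : (thetaIndexOfInitial D).Fibre (Val.non u)), u ∉ Sq → ‖tq u x‖ = 1)

/-! ## §1. (P) = (U) per packet when the Θ-idele norms are constant on the fibre -/

/-- **Per packet `(j, u)`, `qRegion ⊆ slot hull ↔ qRegion ⊆ full hull` when `‖t_{Θ,j,v̲}‖` does not depend on `v̲ ∈ V̲_u`** (non-zero Θ-ideles): the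
antecedents of the two radii-form deciders (p470778, LAST slot; abc-iut-w5-d166, ALL slots) coincide summand by summand; radii witnesses chosen by
abc-iut-w4-d026's `exists_shellRadii_witnesses`. Generalises `qRegion_subset_thetaSlotHull_iff_thetaHull_settingPrVolSharpM_of_subsingleton` (p473654).
[cite: Mochizuki2012, IUTchIII Cor. 3.12 Step (x) p. 181, Step (xi-f) p. 184] [cite: DupuyHilado2025, §4.9, §4.11–4.12] -/
theorem qRegion_subset_thetaSlotHull_iff_thetaHull_settingPrVolSharpM_of_norm_const (ht0 : ∀ u i x, t u i x ≠ 0)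
    (j : (thetaIndexOfInitial D).Label) (u : FinitePlace ℚ)
    (hΘ : ∀ x y : (thetaIndexOfInitial D).Fibre (Val.non u),
      ‖(presAtM D hlog u).labelIdele (t u) j x‖ = ‖(presAtM D hlog u).labelIdele (t u) j y‖) :
    (settingPrVolSharpM D hlog t tq M archPk archSub Ψ act Mmod region n lat sig split qData htq0 Sq htq1).qRegion j (Val.non u) ⊆
      (settingPrVolSharpM D hlog t tq M archPk archSub Ψ act Mmod region n lat sig split qData htq0 Sq htq1).thetaSlotHull j (Val.non u) ↔
    (settingPrVolSharpM D hlog t tq M archPk archSub Ψ act Mmod region n lat sig split qData htq0 Sq htq1).qRegion j (Val.non u) ⊆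
      (settingPrVolSharpM D hlog t tq M archPk archSub Ψ act Mmod region n lat sig split qData htq0 Sq htq1).thetaHull j (Val.non u) := by
  classical
  have hw := fun (u' : FinitePlace ℚ) (x : (thetaIndexOfInitial D).Fibre (Val.non u')) =>
    exists_shellRadii_witnesses (ratChar u') (K := kOfM D (ratChar u') u' (natCast_ratChar_mem u') x)
  choose cin cout hin0 hin hmax _hout0 houtΛ hdom using hw
  rw [qRegion_subset_thetaSlotHull_settingPrVolSharpM_iff_radii D hlog t tq M archPk archSub Ψ act Mmod region n lat sig split qData htq0 Sq htq1
      ht0 cin cout hin0 hin hmax houtΛ hdom j u,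
    qRegion_subset_thetaHull_settingPrVolSharpM_iff_radii D hlog t tq M archPk archSub Ψ act Mmod region n lat sig split qData htq0 Sq htq1
      ht0 cin cout hin0 hin hmax houtΛ hdom j u]
  refine forall_congr' fun e => forall_congr' fun m => imp_congr ?_ Iff.rfl
  refine ⟨fun h a J => ?_, fun h J => h (Fin.last _) J⟩
  have hnum : (ratChar u : ℝ) ^ m * ‖(presAtM D hlog u).labelIdele (t u) j (e a)‖ =
      (ratChar u : ℝ) ^ m * ‖(presAtM D hlog u).labelIdele (t u) j (e (Fin.last _))‖ := by rw [hΘ (e a) (e (Fin.last _))]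
  exact (le_of_eq hnum).trans (h J)

/-! ## §2. The two licences coincide under fibrewise norm-constancy -/

/-- **`SlotLicence ↔ Licence` at the M-level setting when, at every finite rational place `u` and label `i`, `‖t_{Θ,i+1,v̲}‖` is constant over `v̲ ∈ V̲_u`**
(non-zero Θ-ideles; archimedean packets automatic on both sides). Generalises `slotLicence_iff_licence_settingPrVolSharpM_of_subsingleton` (p473654).
[cite: Mochizuki2012, IUTchIII Cor. 3.12 Step (xi-f) p. 184; Thm. 3.11 (i) (Ind1) p. 154] [cite: DupuyHilado2025, §4.11–4.12] -/
theorem slotLicence_iff_licence_settingPrVolSharpM_of_norm_const (ht0 : ∀ u i x, t u i x ≠ 0)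
    (hΘ : ∀ (u : FinitePlace ℚ) (i : Fin (thetaIndexOfInitial D).lstar) (x y : (thetaIndexOfInitial D).Fibre (Val.non u)),
      ‖t u i x‖ = ‖t u i y‖) :
    (settingPrVolSharpM D hlog t tq M archPk archSub Ψ act Mmod region n lat sig split qData htq0 Sq htq1).SlotLicence ↔
      Thm311ToCor312.Licence (settingPrVolSharpM D hlog t tq M archPk archSub Ψ act Mmod region n lat sig split qData htq0 Sq htq1) := by
  refine forall_congr' fun i => forall_congr' fun vQ => ?_
  rcases vQ with w | u
  · exact ⟨fun _ => qRegion_subset_thetaHull_settingPrVolSharpM_arc D hlog t tq M archPk archSub Ψ act Mmod region n lat sig split qData htq0 Sq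
        htq1 _ w,
      fun _ => qRegion_subset_thetaSlotHull_settingPrVolSharpM_arc D hlog t tq M archPk archSub Ψ act Mmod region n lat sig split qData htq0 Sq
        htq1 _ w⟩
  · refine qRegion_subset_thetaSlotHull_iff_thetaHull_settingPrVolSharpM_of_norm_const D hlog t tq M archPk archSub Ψ act Mmod region n lat sig
      split qData htq0 Sq htq1 ht0 _ u fun x y => ?_
    rw [PadicPresentation.labelIdele_labelSucc, PadicPresentation.labelIdele_labelSucc]
    exact hΘ u i x y

/-- Contrapositive: under fibrewise norm-constancy, **a failure of the SLOT licence is a failure of the (U) licence** (hence of the q-pinned S_H, abc-iut-w5-d068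
`licence_of_pilotKummerCompatHull`): the antecedent of the M γ binders implies that of the M (U) binders. [folklore] -/
theorem not_licence_of_not_slotLicence_settingPrVolSharpM_of_norm_const (ht0 : ∀ u i x, t u i x ≠ 0)
    (hΘ : ∀ (u : FinitePlace ℚ) (i : Fin (thetaIndexOfInitial D).lstar) (x y : (thetaIndexOfInitial D).Fibre (Val.non u)),
      ‖t u i x‖ = ‖t u i y‖)
    (hns : ¬ (settingPrVolSharpM D hlog t tq M archPk archSub Ψ act Mmod region n lat sig split qData htq0 Sq htq1).SlotLicence) :
    ¬ Thm311ToCor312.Licence (settingPrVolSharpM D hlog t tq M archPk archSub Ψ act Mmod region n lat sig split qData htq0 Sq htq1) :=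
  fun hlic => hns ((slotLicence_iff_licence_settingPrVolSharpM_of_norm_const D hlog t tq M archPk archSub Ψ act Mmod region n lat sig split qData
    htq0 Sq htq1 ht0 hΘ).mpr hlic)

end Summit.ABC.IUTFork.Thm311.Real

end
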